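import Summits.BirchSwinnertonDyer.BirchSwinnertonDyer.Theorems.ManinLocalTwoThreeThreeTorsionTangentSlope
import Summits.BirchSwinnertonDyer.BirchSwinnertonDyer.Theorems.ManinLocalTwoThreeShimuraIndexMuThree
import HarnessLib

/-!
# Global Nagell–Lutz for rational `3`-torsion on an integral model, read from the short model `E_{W,c}`
# (route `ManinLocalTwoThree`, crux C3 `ManinPrimeToThreeAtNine` stmt-BirchSwinnertonDyer-22968; cell bsd-f2-manin, prover seat p3 gen 15 —
# integrality input of node (AN1) «`h^{min} ∈ ℤ⟦q⟧`» of -an's UDC line, MEMO-an §80.12 step (5): «`x_T, y_T, λ ∈ ℤ`, `λ² + a₁λ = 3x_T + a₂`»)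

The UDC line carries a rational point of order `3` as `IsShortThreeTorsion W c X₀ Y₀` on the SHORT model
`E_{W,c} : y² = x³ − (c⁴c₄/48)x − c⁶c₆/864`, which is not an integral model (`48, 864`; an's CAUTION: the short normalisation has
unbounded `2`-power denominators).  Node (AN1) needs the point back on the integral model `W`:
`x_T = X₀/c² − b₂/12`, `y_T = Y₀/c³ − (a₁x_T + a₃)/2`, flex slope `λ = α/c − a₁/2` — and needs them INTEGRAL, so that
`Θ^{min} = z_W³·(y − y_T − λ(x − x_T)) ∈ ℤ⟦q⟧`.  This file proves exactly that, for any `W/ℚ` with `W.IsIntegral ℤ` and `c ≠ 0`: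

* `den_dvd_three_of_psiThree_eq_zero` — a rational root of `3x⁴ + B₂x³ + 3B₄x² + 3B₆x + B₈` (`Bᵢ ∈ ℤ`) has denominator `∣ 3`;
* `false_of_sq_eq_cubic_of_den_eq_three` — if moreover `s² = 4x³ + B₂x² + 2B₄x + B₆` for some rational `s` then the denominator is
  not `3` (`x = n/3`, `3 ∤ n` gives `(9s)² = 3M`, `M ≡ 4n³ ≢ 0 (mod 3)`: `v₃` of a square is even);
* `den_eq_one_of_monic_quadratic` — a rational root of `y² + Py + Q` (`P, Q ∈ ℤ`) is an integer;
* **`den_eq_one_of_isRoot_Ψ₃`** — on an integral model, an affine point `(x, y)` whose abscissa is a root of the `3`-division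
  polynomial `Ψ₃` has `x, y ∈ ℤ` (global Nagell–Lutz for `3`-torsion, with no `2`-adic exception since `T ∉ E[2]` is not even
  needed: `Ψ₃` alone pins `den x ∣ 3`);
* **`den_eq_one_of_isShortThreeTorsion`**, **`flexSlope_sq_add_of_isShortThreeTorsion`**, **`den_flexSlope_eq_one_of_isShortThreeTorsion`**
  — the transport to the UDC line's binders: `x_T, y_T ∈ ℤ`, `λ² + a₁λ = a₂ + 3x_T`, `λ ∈ ℤ` (the flex identity is the tree's
  `tangentSlope_sq_eq_three_mul`, `α² = 3X₀`, moved through `X₀ = c²(x_T + b₂/12)`; `Ψ₃` is covariant of weight `u⁻⁸ = c⁸`; `isRoot_Ψ₃_iff` is the tree's, `…ShimuraIndexMuThree`).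

HONEST FRAMING.  Elementary arithmetic of Weierstrass equations; nothing about (AN1), C3, Manin's conjecture or BSD is proved here.
[cite: SilvermanAEC2009, VII.3.4 and VIII.7.1 (Nagell–Lutz: torsion points on integral models are integral; here only the order-3 case, via Ψ₃)]
[cite: SilvermanAEC2009, III.1 (change of variables `x = u²x' + r`, `y = u³y' + su²x' + t`; covariance of `b₂, c₄, c₆`) and Ex. 3.7 (division polynomials)]
-/

set_option autoImplicit false
-- lint-debt: the directory name repeats the summit name (sibling precedent `ManinLocalTwoThreeThreeTorsionTangentSlope.lean`)
set_option linter.dupNamespace false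

noncomputable section

open Polynomial WeierstrassCurve
open Summit.BirchSwinnertonDyer.Rank1Residual.ManinAdditive.CuspidalKummer
open Summit.BirchSwinnertonDyer.Rank1Residual.ManinAdditive.CuspidalKummerThree

namespace Summit.BirchSwinnertonDyer.BirchSwinnertonDyer.Theorems.ManinLocalTwoThree.MinimalThreeTorsion

/-! ## §1 Three facts about denominators -/

/-- A rational root `x` of `3x⁴ + B₂x³ + 3B₄x² + 3B₆x + B₈` with `Bᵢ ∈ ℤ` has `den x ∣ 3` (rational root theorem: `den ∣ 3·num⁴`,
`gcd(num, den) = 1`). [folklore] -/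
theorem den_dvd_three_of_psiThree_eq_zero {B₂ B₄ B₆ B₈ : ℤ} {x : ℚ}
    (h : 3 * x ^ 4 + B₂ * x ^ 3 + 3 * B₄ * x ^ 2 + 3 * B₆ * x + B₈ = 0) : x.den ∣ 3 := by
  set n : ℤ := x.num with hn
  set d : ℕ := x.den with hd
  have hd0 : (d : ℚ) ≠ 0 := by exact_mod_cast x.den_nz
  have hx : x = n / d := (Rat.num_div_den x).symm
  have key : ((3 * n ^ 4 + B₂ * n ^ 3 * d + 3 * B₄ * n ^ 2 * d ^ 2 + 3 * B₆ * n * d ^ 3 + B₈ * d ^ 4 : ℤ) : ℚ)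
      = (d : ℚ) ^ 4 * (3 * x ^ 4 + B₂ * x ^ 3 + 3 * B₄ * x ^ 2 + 3 * B₆ * x + B₈) := by
    rw [hx]; field_simp; push_cast; ring
  rw [h, mul_zero] at key
  have key' : (3 * n ^ 4 + B₂ * n ^ 3 * d + 3 * B₄ * n ^ 2 * d ^ 2 + 3 * B₆ * n * d ^ 3 + B₈ * d ^ 4 : ℤ) = 0 := by
    exact_mod_cast key
  have hdvd : (d : ℤ) ∣ 3 * n ^ 4 :=
    ⟨-(B₂ * n ^ 3 + 3 * B₄ * n ^ 2 * d + 3 * B₆ * n * d ^ 2 + B₈ * d ^ 3), by linear_combination key'⟩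
  have hcop : IsCoprime (d : ℤ) n := by
    rw [Int.isCoprime_iff_gcd_eq_one, Int.gcd_comm]
    simpa [Int.gcd, hn, hd] using x.reduced
  have h3 : (d : ℤ) ∣ 3 := (hcop.pow_right (n := 4)).dvd_of_dvd_mul_right hdvd
  exact_mod_cast h3

/-- If `s² = 4x³ + B₂x² + 2B₄x + B₆` (`Bᵢ ∈ ℤ`, `s ∈ ℚ`) then `den x ≠ 3`: with `x = n/3`, `3 ∤ n`, one gets `(9s)² = 3M` with
`M = 4n³ + 3B₂n² + 18B₄n + 27B₆ ≡ 4n³ ≢ 0 (mod 3)`, but `9s ∈ ℤ` and `3 ∣ (9s)² ⇒ 9 ∣ 3M ⇒ 3 ∣ M`. [folklore] -/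
theorem false_of_sq_eq_cubic_of_den_eq_three {B₂ B₄ B₆ : ℤ} {x s : ℚ}
    (hs : s ^ 2 = 4 * x ^ 3 + B₂ * x ^ 2 + 2 * B₄ * x + B₆) (hd : x.den = 3) : False := by
  have hx : x = x.num / 3 := by
    have := (Rat.num_div_den x).symm
    rwa [hd] at this
  have hcop : x.num.natAbs.Coprime 3 := by simpa [hd] using x.reduced
  have ht : (9 * s) ^ 2 = ((3 * (4 * x.num ^ 3 + 3 * B₂ * x.num ^ 2 + 18 * B₄ * x.num + 27 * B₆) : ℤ) : ℚ) := by
    rw [hx] at hs; push_cast; linear_combination 81 * hs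
  have htden : (9 * s).den = 1 := by
    have h1 : ((9 * s) ^ 2).den = 1 := by rw [ht]; exact Rat.den_intCast _
    rw [Rat.den_pow] at h1
    exact (Nat.pow_eq_one.mp h1).resolve_right two_ne_zero
  have hTq : ((9 * s).num : ℚ) = 9 * s := Rat.coe_int_num_of_den_eq_one htden
  have hT2 : (9 * s).num ^ 2 = 3 * (4 * x.num ^ 3 + 3 * B₂ * x.num ^ 2 + 18 * B₄ * x.num + 27 * B₆) := by
    have h' : (((9 * s).num : ℤ) : ℚ) ^ 2
        = ((3 * (4 * x.num ^ 3 + 3 * B₂ * x.num ^ 2 + 18 * B₄ * x.num + 27 * B₆) : ℤ) : ℚ) := by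
      rw [hTq]; exact ht
    exact_mod_cast h'
  obtain ⟨T', hT'⟩ : (3 : ℤ) ∣ (9 * s).num := Int.prime_three.dvd_of_dvd_pow (n := 2) ⟨_, hT2⟩
  rw [hT'] at hT2
  have hT3 : 3 * T' ^ 2 = 4 * x.num ^ 3 + 3 * B₂ * x.num ^ 2 + 18 * B₄ * x.num + 27 * B₆ :=
    mul_left_cancel₀ (three_ne_zero' ℤ) (by linear_combination hT2)
  have h3n3 : (3 : ℤ) ∣ 4 * x.num ^ 3 :=
    ⟨T' ^ 2 - (B₂ * x.num ^ 2 + 6 * B₄ * x.num + 9 * B₆), by linear_combination (-1 : ℤ) * hT3⟩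
  have h3n : (3 : ℤ) ∣ x.num := by
    rcases Int.prime_three.dvd_or_dvd h3n3 with h4 | h4
    · norm_num at h4
    · exact Int.prime_three.dvd_of_dvd_pow h4
  have h3n' : 3 ∣ x.num.natAbs := by
    have := Int.natAbs_dvd_natAbs.mpr h3n; simpa using this
  have := Nat.dvd_gcd h3n' (dvd_refl 3)
  rw [hcop.gcd_eq_one] at this
  norm_num at this

/-- A rational root `y` of a monic integer quadratic `y² + Py + Q` is an integer (`den ∣ num²`, coprime). [folklore] -/
theorem den_eq_one_of_monic_quadratic {P Q : ℤ} {y : ℚ} (h : y ^ 2 + P * y + Q = 0) : y.den = 1 := by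
  set m : ℤ := y.num with hm
  set e : ℕ := y.den with he
  have he0 : (e : ℚ) ≠ 0 := by exact_mod_cast y.den_nz
  have hy : y = m / e := (Rat.num_div_den y).symm
  have key : ((m ^ 2 + P * m * e + Q * e ^ 2 : ℤ) : ℚ) = (e : ℚ) ^ 2 * (y ^ 2 + P * y + Q) := by
    rw [hy]; field_simp; push_cast; ring
  rw [h, mul_zero] at key
  have key' : (m ^ 2 + P * m * e + Q * e ^ 2 : ℤ) = 0 := by exact_mod_cast key
  have hdvd : (e : ℤ) ∣ m ^ 2 := ⟨-(P * m + Q * e), by linear_combination key'⟩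
  have hcop : IsCoprime (e : ℤ) m := by
    rw [Int.isCoprime_iff_gcd_eq_one, Int.gcd_comm]
    simpa [Int.gcd, hm, he] using y.reduced
  have hu : IsUnit (e : ℤ) := (hcop.pow_right (n := 2)).isUnit_of_dvd' (dvd_refl _) hdvd
  have := Int.isUnit_iff_natAbs_eq.mp hu
  simpa using this

/-! ## §2 Global Nagell–Lutz for `3`-torsion on an integral model -/

/-- The completed-square form of a Weierstrass equation: `(2y + a₁x + a₃)² = 4x³ + b₂x² + 2b₄x + b₆`. [cite: SilvermanAEC2009, III.1 (p. 42)] -/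
theorem sq_eq_cubic_of_equation (W : WeierstrassCurve ℚ) {x y : ℚ} (heq : W.toAffine.Equation x y) :
    (2 * y + W.a₁ * x + W.a₃) ^ 2 = 4 * x ^ 3 + W.b₂ * x ^ 2 + 2 * W.b₄ * x + W.b₆ := by
  have h := (Affine.equation_iff _ _).mp heq
  simp only [WeierstrassCurve.b₂, WeierstrassCurve.b₄, WeierstrassCurve.b₆]
  linear_combination 4 * h

/-- **Global Nagell–Lutz for `3`-torsion.**  On an integral Weierstrass model `W/ℚ` (`W.IsIntegral ℤ`), an affine point `(x, y)`
whose abscissa is a root of the `3`-division polynomial `Ψ₃` (i.e. a point of order `3`) has integer coordinates: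
`Ψ₃` has leading coefficient `3`, so `den x ∣ 3`; `den x = 3` would make `v₃(4x³ + b₂x² + 2b₄x + b₆) = −3` odd, impossible for the
square `(2y + a₁x + a₃)²`; then `y` is a root of a monic integer quadratic.
[cite: SilvermanAEC2009, VII.3.4 (torsion points on integral models have integral coordinates; order-3 case)] -/
theorem den_eq_one_of_isRoot_Ψ₃ (W : WeierstrassCurve ℚ) [hW : W.IsIntegral ℤ] {x y : ℚ}
    (heq : W.toAffine.Equation x y) (hΨ : W.Ψ₃.IsRoot x) : x.den = 1 ∧ y.den = 1 := by
  obtain ⟨V, hV⟩ := hW.integral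
  have ha₁ : W.a₁ = (V.a₁ : ℚ) := by rw [hV]; rfl
  have ha₂ : W.a₂ = (V.a₂ : ℚ) := by rw [hV]; rfl
  have ha₃ : W.a₃ = (V.a₃ : ℚ) := by rw [hV]; rfl
  have ha₄ : W.a₄ = (V.a₄ : ℚ) := by rw [hV]; rfl
  have ha₆ : W.a₆ = (V.a₆ : ℚ) := by rw [hV]; rfl
  have hb₂ : W.b₂ = (V.b₂ : ℚ) := by simp only [WeierstrassCurve.b₂, ha₁, ha₂]; push_cast; ring
  have hb₄ : W.b₄ = (V.b₄ : ℚ) := by simp only [WeierstrassCurve.b₄, ha₁, ha₃, ha₄]; push_cast; ring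
  have hb₆ : W.b₆ = (V.b₆ : ℚ) := by simp only [WeierstrassCurve.b₆, ha₃, ha₆]; push_cast; ring
  have hb₈ : W.b₈ = (V.b₈ : ℚ) := by
    simp only [WeierstrassCurve.b₈, ha₁, ha₂, ha₃, ha₄, ha₆]; push_cast; ring
  have hΨ' := (isRoot_Ψ₃_iff W x).mp hΨ
  rw [hb₂, hb₄, hb₆, hb₈] at hΨ'
  have hsq := sq_eq_cubic_of_equation W heq
  rw [hb₂, hb₄, hb₆] at hsq
  -- `den x ∣ 3`, and `den x ≠ 3`
  have hx1 : x.den = 1 := by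
    rcases (Nat.dvd_prime Nat.prime_three).mp (den_dvd_three_of_psiThree_eq_zero hΨ') with h1 | h3
    · exact h1
    · exact (false_of_sq_eq_cubic_of_den_eq_three hsq h3).elim
  refine ⟨hx1, ?_⟩
  -- `y` is a root of the monic integer quadratic `y² + (a₁x + a₃)y − (x³ + a₂x² + a₄x + a₆)`
  have hxq : (x.num : ℚ) = x := Rat.coe_int_num_of_den_eq_one hx1
  have h := (Affine.equation_iff _ _).mp heq
  rw [ha₁, ha₂, ha₃, ha₄, ha₆, ← hxq] at h
  refine den_eq_one_of_monic_quadratic (P := V.a₁ * x.num + V.a₃)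
    (Q := -(x.num ^ 3 + V.a₂ * x.num ^ 2 + V.a₄ * x.num + V.a₆)) ?_
  push_cast
  linear_combination h

/-! ## §3 Transport from the short model `E_{W,c}` of the UDC line -/

/-- `X₀ = c²(x_T + b₂/12)` for `x_T := X₀/c² − b₂/12` (`c ≠ 0`). [cite: SilvermanAEC2009, III.1] -/
theorem shortX_eq (W : WeierstrassCurve ℚ) {c : ℤ} (hc : c ≠ 0) (X₀ : ℚ) :
    X₀ = (c : ℚ) ^ 2 * ((X₀ / (c : ℚ) ^ 2 - W.b₂ / 12) + W.b₂ / 12) := by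
  have hc' : (c : ℚ) ≠ 0 := by exact_mod_cast hc
  field_simp
  ring

/-- `Y₀ = c³(y_T + (a₁x_T + a₃)/2)` for `y_T := Y₀/c³ − (a₁x_T + a₃)/2` (`c ≠ 0`). [cite: SilvermanAEC2009, III.1] -/
theorem shortY_eq (W : WeierstrassCurve ℚ) {c : ℤ} (hc : c ≠ 0) (X₀ Y₀ : ℚ) :
    Y₀ = (c : ℚ) ^ 3 * ((Y₀ / (c : ℚ) ^ 3 - (W.a₁ * (X₀ / (c : ℚ) ^ 2 - W.b₂ / 12) + W.a₃) / 2)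
      + (W.a₁ * (X₀ / (c : ℚ) ^ 2 - W.b₂ / 12) + W.a₃) / 2) := by
  have hc' : (c : ℚ) ≠ 0 := by exact_mod_cast hc
  field_simp
  ring

/-- **The short-model point read on `W`: it satisfies `W`'s equation.**  With `x_T = X₀/c² − b₂/12`, `y_T = Y₀/c³ − (a₁x_T + a₃)/2`:
`c⁶·(W's equation at (x_T, y_T)) = (E_{W,c}'s equation at (X₀, Y₀))` identically (`c₄ = b₂² − 24b₄`, `c₆ = −b₂³ + 36b₂b₄ − 216b₆`).
[cite: SilvermanAEC2009, III.1 (Table 3.1)] -/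
theorem equation_of_isShortThreeTorsion' (W : WeierstrassCurve ℚ) {c : ℤ} (hc : c ≠ 0) {X₀ Y₀ : ℚ}
    (hT : IsShortThreeTorsion W c X₀ Y₀) :
    W.toAffine.Equation (X₀ / (c : ℚ) ^ 2 - W.b₂ / 12)
      (Y₀ / (c : ℚ) ^ 3 - (W.a₁ * (X₀ / (c : ℚ) ^ 2 - W.b₂ / 12) + W.a₃) / 2) := by
  set x := X₀ / (c : ℚ) ^ 2 - W.b₂ / 12 with hx
  set y := Y₀ / (c : ℚ) ^ 3 - (W.a₁ * x + W.a₃) / 2 with hy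
  have hc' : (c : ℚ) ≠ 0 := by exact_mod_cast hc
  have hX : X₀ = (c : ℚ) ^ 2 * (x + W.b₂ / 12) := shortX_eq W hc X₀
  have hY : Y₀ = (c : ℚ) ^ 3 * (y + (W.a₁ * x + W.a₃) / 2) := shortY_eq W hc X₀ Y₀
  have heqS := equation_of_isShortThreeTorsion hT
  have h4 : (shortModel W c).a₄ = -((c : ℚ) ^ 4 * W.c₄ / 48) := rfl
  have h6 : (shortModel W c).a₆ = -((c : ℚ) ^ 6 * W.c₆ / 864) := rfl
  rw [h4, h6] at heqS
  rw [Affine.equation_iff]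
  have key : (c : ℚ) ^ 6 * (y ^ 2 + W.a₁ * x * y + W.a₃ * y - (x ^ 3 + W.a₂ * x ^ 2 + W.a₄ * x + W.a₆))
      = Y₀ ^ 2 - (X₀ ^ 3 + -((c : ℚ) ^ 4 * W.c₄ / 48) * X₀ + -((c : ℚ) ^ 6 * W.c₆ / 864)) := by
    rw [hX, hY]
    simp only [WeierstrassCurve.c₄, WeierstrassCurve.c₆, WeierstrassCurve.b₂, WeierstrassCurve.b₄, WeierstrassCurve.b₆]
    ring
  rw [heqS, sub_self, mul_eq_zero] at key
  rcases key with h0 | h0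
  · exact absurd ((pow_eq_zero_iff (by norm_num)).mp h0) hc'
  · linear_combination h0

/-- **`Ψ₃` is covariant of weight `c⁸`**: `Ψ₃^{E_{W,c}}(X₀) = c⁸ · Ψ₃^{W}(x_T)`; hence `x_T` is a root of `W.Ψ₃`.
[cite: SilvermanAEC2009, Ex. 3.7 (division polynomials) and III.1] -/
theorem isRoot_Ψ₃_of_isShortThreeTorsion (W : WeierstrassCurve ℚ) {c : ℤ} (hc : c ≠ 0) {X₀ Y₀ : ℚ}
    (hT : IsShortThreeTorsion W c X₀ Y₀) : W.Ψ₃.IsRoot (X₀ / (c : ℚ) ^ 2 - W.b₂ / 12) := by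
  set x := X₀ / (c : ℚ) ^ 2 - W.b₂ / 12 with hx
  have hc' : (c : ℚ) ≠ 0 := by exact_mod_cast hc
  have hX : X₀ = (c : ℚ) ^ 2 * (x + W.b₂ / 12) := shortX_eq W hc X₀
  have hΨ := (isRoot_Ψ₃_shortModel_iff W c X₀).mp hT.2
  have h4 : (shortModel W c).a₄ = -((c : ℚ) ^ 4 * W.c₄ / 48) := rfl
  have h6 : (shortModel W c).a₆ = -((c : ℚ) ^ 6 * W.c₆ / 864) := rfl
  rw [h4, h6] at hΨ
  rw [isRoot_Ψ₃_iff]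
  have key : (c : ℚ) ^ 8 * (3 * x ^ 4 + W.b₂ * x ^ 3 + 3 * W.b₄ * x ^ 2 + 3 * W.b₆ * x + W.b₈)
      = 3 * X₀ ^ 4 + 6 * -((c : ℚ) ^ 4 * W.c₄ / 48) * X₀ ^ 2 + 12 * -((c : ℚ) ^ 6 * W.c₆ / 864) * X₀
        - (-((c : ℚ) ^ 4 * W.c₄ / 48)) ^ 2 := by
    rw [hX]
    simp only [WeierstrassCurve.c₄, WeierstrassCurve.c₆, WeierstrassCurve.b₂, WeierstrassCurve.b₄, WeierstrassCurve.b₆,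
      WeierstrassCurve.b₈]
    ring
  rw [hΨ, mul_eq_zero] at key
  rcases key with h0 | h0
  · exact absurd ((pow_eq_zero_iff (by norm_num)).mp h0) hc'
  · exact h0

/-- **Global Nagell–Lutz for the UDC line's rational `3`-torsion point**: for `W/ℚ` integral, `c ≠ 0` and `(X₀, Y₀)` a point of order
`3` of `E_{W,c}`, the `W`-coordinates `x_T = X₀/c² − b₂/12` and `y_T = Y₀/c³ − (a₁x_T + a₃)/2` are integers.
[cite: SilvermanAEC2009, VII.3.4 (order-3 case)] -/
theorem den_eq_one_of_isShortThreeTorsion (W : WeierstrassCurve ℚ) [W.IsIntegral ℤ] {c : ℤ} (hc : c ≠ 0) {X₀ Y₀ : ℚ}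
    (hT : IsShortThreeTorsion W c X₀ Y₀) :
    (X₀ / (c : ℚ) ^ 2 - W.b₂ / 12).den = 1 ∧
      (Y₀ / (c : ℚ) ^ 3 - (W.a₁ * (X₀ / (c : ℚ) ^ 2 - W.b₂ / 12) + W.a₃) / 2).den = 1 :=
  den_eq_one_of_isRoot_Ψ₃ W (equation_of_isShortThreeTorsion' W hc hT) (isRoot_Ψ₃_of_isShortThreeTorsion W hc hT)

/-- **The flex identity on `W`: `λ² + a₁λ = a₂ + 3x_T`** for the tangent slope `λ = α/c − a₁/2` at the `3`-torsion point
(`α` = the short model's `tangentSlope`, `α² = 3X₀` by the tree's `tangentSlope_sq_eq_three_mul`). [cite: SilvermanAEC2009, III.2.3 (duplication: `x(2T) = λ² + a₁λ − a₂ − 2x_T = x_T`)] -/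
theorem flexSlope_sq_add_of_isShortThreeTorsion (W : WeierstrassCurve ℚ) {c : ℤ} (hc : c ≠ 0) {X₀ Y₀ : ℚ}
    (hT : IsShortThreeTorsion W c X₀ Y₀) :
    (tangentSlope W c X₀ Y₀ / c - W.a₁ / 2) ^ 2 + W.a₁ * (tangentSlope W c X₀ Y₀ / c - W.a₁ / 2)
      = W.a₂ + 3 * (X₀ / (c : ℚ) ^ 2 - W.b₂ / 12) := by
  have hc' : (c : ℚ) ≠ 0 := by exact_mod_cast hc
  have hα := tangentSlope_sq_eq_three_mul hT
  have key : (c : ℚ) ^ 2 * ((tangentSlope W c X₀ Y₀ / c - W.a₁ / 2) ^ 2 + W.a₁ * (tangentSlope W c X₀ Y₀ / c - W.a₁ / 2)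
      - (W.a₂ + 3 * (X₀ / (c : ℚ) ^ 2 - W.b₂ / 12))) = tangentSlope W c X₀ Y₀ ^ 2 - 3 * X₀ := by
    simp only [WeierstrassCurve.b₂]
    field_simp
    ring
  rw [hα, sub_self, mul_eq_zero] at key
  rcases key with h0 | h0
  · exact absurd ((pow_eq_zero_iff (by norm_num)).mp h0) hc'
  · exact sub_eq_zero.mp h0

/-- **`λ ∈ ℤ`**: the flex slope `λ = α/c − a₁/2` is a root of the monic integer quadratic `λ² + a₁λ − (a₂ + 3x_T)` (`x_T ∈ ℤ`).
[cite: SilvermanAEC2009, VII.3.4 and III.2.3] -/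
theorem den_flexSlope_eq_one_of_isShortThreeTorsion (W : WeierstrassCurve ℚ) [hW : W.IsIntegral ℤ] {c : ℤ} (hc : c ≠ 0)
    {X₀ Y₀ : ℚ} (hT : IsShortThreeTorsion W c X₀ Y₀) : (tangentSlope W c X₀ Y₀ / c - W.a₁ / 2).den = 1 := by
  obtain ⟨V, hV⟩ := hW.integral
  have ha₁ : W.a₁ = (V.a₁ : ℚ) := by rw [hV]; rfl
  have ha₂ : W.a₂ = (V.a₂ : ℚ) := by rw [hV]; rfl
  have hflex := flexSlope_sq_add_of_isShortThreeTorsion W hc hT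
  have hx1 := (den_eq_one_of_isShortThreeTorsion W hc hT).1
  have hxq : ((X₀ / (c : ℚ) ^ 2 - W.b₂ / 12).num : ℚ) = X₀ / (c : ℚ) ^ 2 - W.b₂ / 12 :=
    Rat.coe_int_num_of_den_eq_one hx1
  rw [← hxq] at hflex
  refine den_eq_one_of_monic_quadratic (P := V.a₁) (Q := -(V.a₂ + 3 * (X₀ / (c : ℚ) ^ 2 - W.b₂ / 12).num)) ?_
  push_cast
  rw [← ha₁, ← ha₂]
  linear_combination hflex

/-- **UDC-line form** (binders of (AN)/(AN1): a modular parametrisation datum `D` of a globally minimal `W`, so `W.IsIntegral ℤ` and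
`D.c ≠ 0` are tree facts): the rational `3`-torsion point and its flex slope are integral on `W`. [cite: SilvermanAEC2009, VII.3.4] -/
theorem minimalThreeTorsion_integral (W : WeierstrassCurve ℚ) [W.IsElliptic] [W.IsGloballyMinimal] {N : ℕ} [NeZero N]
    (D : Literature.NumberTheory.EllipticCurves.ModularForms.ModularParametrizationData W N) {X₀ Y₀ : ℚ}
    (hT : IsShortThreeTorsion W D.c X₀ Y₀) :
    (X₀ / (D.c : ℚ) ^ 2 - W.b₂ / 12).den = 1 ∧
      (Y₀ / (D.c : ℚ) ^ 3 - (W.a₁ * (X₀ / (D.c : ℚ) ^ 2 - W.b₂ / 12) + W.a₃) / 2).den = 1 ∧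
      (tangentSlope W D.c X₀ Y₀ / D.c - W.a₁ / 2).den = 1 ∧
      (tangentSlope W D.c X₀ Y₀ / D.c - W.a₁ / 2) ^ 2 + W.a₁ * (tangentSlope W D.c X₀ Y₀ / D.c - W.a₁ / 2)
        = W.a₂ + 3 * (X₀ / (D.c : ℚ) ^ 2 - W.b₂ / 12) := by
  have hc : D.c ≠ 0 := D.maninConstant_ne_zero_holds
  obtain ⟨h1, h2⟩ := den_eq_one_of_isShortThreeTorsion W hc hT
  exact ⟨h1, h2, den_flexSlope_eq_one_of_isShortThreeTorsion W hc hT, flexSlope_sq_add_of_isShortThreeTorsion W hc hT⟩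

end Summit.BirchSwinnertonDyer.BirchSwinnertonDyer.Theorems.ManinLocalTwoThree.MinimalThreeTorsion

end
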